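import Summits.CriticalPhenomena.SAWScalingLimit.Theorems.SAWLeftRightFKGFKGToTraversalBoundWitnessMonoOneSided
import Summits.CriticalPhenomena.SAWScalingLimit.Theorems.SAWLeftRightFKGFKGToTraversalBoundWitnessMonoPositions
import Summits.CriticalPhenomena.SAWScalingLimit.Theorems.SAWLeftRightFKGFKGToTraversalBoundWitnessMonoEscapes
import HarnessLib

/-!
# Witness glue T5: block-monotone contact index on a far piece along the outline arc

Crux `SAWLeftRightFKG.FKGToTraversalBound` (stmt-CriticalPhenomena-1878), line `slit-necklace`, lead
prover-line-stmt-CriticalPhenomena-1878-c5-0; witness glue unit T5, part 4 of 4: the registered stub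
`witness_blockMonotone` of the planar-witness skeleton `stub_necklaceWitnessFarU`.

Setting (`FarTipCfg`, …WitnessCfg.lean): the free component `F` of the far tip `t₀` with its wall-follower tour
`btour F e₀` of period `N` without repeats, an outline arc walk `p` whose vertices carry monotone positions
`φ k ∈ [m, n]` (`(m, n) = (0, n₁)` or `(n₁, N)`), and a NON-DEGENERATE far piece `(i'', cfg.pend i'')` other than
the piece of the configuration.  Claim: off one cut `kcut`, the chord index of those contacts
`bcontact (btour F e₀ (φ k))` that are interior vertices of the piece is non-decreasing in `k`, or non-increasing.

Proof (assembly of parts 1–3): the piece, read as a lattice path `r` (`mono_chordSlice`), is an obstacle off `F`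
(its vertices are attached, `mono_mem_K`); the escapes of `mono_escapes` from its two spine endpoints, from the
contact `γ(τ-1)` of `e₀` and from every outside neighbour of `F` (attached or trace sites, by the contact
classification) feed `mono_oneSided` (all contacts LEFT or all RIGHT) and then `mono_posMonotone_left` /
`mono_posMonotone_right` (block-monotone index along positions `q < q' < N`); finally positions are pulled back
to vertex indices of `p` through the monotone `φ` (`mono_cut_transfer`; the position `N` carries the contact
`γ(τ-1)`, which is not interior to the piece).

All statements folklore; no literature fact; nothing restates the crux.
-/

noncomputable section

open Set
open Literature.Probability.LatticeModels
open Literature.Probability.RandomPlanarGeometry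
open Summit.CriticalPhenomena.SAWScalingLimit.Theorems.FKGToTraversalBound.Negative (dom)

namespace Summit.CriticalPhenomena.SAWScalingLimit.Theorems.FKGToTraversalBound.SlitNecklace

variable {D : DobrushinDomain}

/-! ### The piece as a lattice path -/

/-- **A slice of the chord as a lattice path**: for `i ≤ j ≤ |γ|`, a lattice path from `γ i` to `γ j` of length
`j - i` whose `k`-th vertex is `γ (i + k)`. [folklore] -/
theorem mono_chordSlice (cfg : FarTipCfg D) {i j : ℕ} (hij : i ≤ j) (hj : j ≤ cfg.γ.length) :
    ∃ r : (zdGraph 2).Walk (cfg.γ.getVert i) (cfg.γ.getVert j), r.IsPath ∧ r.length = j - i ∧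
      ∀ k, k ≤ j - i → r.getVert k = cfg.γ.getVert (i + k) := by
  have hGle : cfg.Dg ≤ zdGraph 2 := (discreteDomainGraph_le_meshGraph _ _).trans (meshGraph_le_zdGraph _ _)
  set γ' := cfg.γ.mapLe hGle with hγ'
  have hgv : ∀ n, γ'.getVert n = cfg.γ.getVert n := fun n => by
    show (cfg.γ.map (SimpleGraph.Hom.ofLE hGle)).getVert n = cfg.γ.getVert n
    rw [SimpleGraph.Walk.getVert_map]
    rfl
  have hlen : γ'.length = cfg.γ.length := SimpleGraph.Walk.length_map _ _
  have hend : (γ'.drop i).getVert (j - i) = cfg.γ.getVert j := by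
    rw [SimpleGraph.Walk.drop_getVert, hgv]
    congr 1
    omega
  refine ⟨((γ'.drop i).take (j - i)).copy (hgv i) hend, ?_, ?_, ?_⟩
  · simpa using ((cfg.hγ.mapLe hGle).drop i).take (j - i)
  · rw [SimpleGraph.Walk.length_copy, SimpleGraph.Walk.take_length, SimpleGraph.Walk.drop_length, hlen]
    omega
  · intro k hk
    rw [SimpleGraph.Walk.getVert_copy, SimpleGraph.Walk.take_getVert, SimpleGraph.Walk.drop_getVert, hgv]
    congr 1
    omega

/-! ### From positions to vertex indices -/

/-- **Pulling a cut back through a monotone map.**  `P q a` ("position `q` carries the value `a`") is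
functional in `a` and void at position `N`; `φ` is monotone on `[0, len]` with values `≤ n ≤ N`; if `rel` is
reflexive and holds between the values at positions `q < q' < N` not straddling `kpos`, then it holds between the
values at `φ k`, `φ k'` for `k < k' ≤ len` not straddling some `kcut`. [folklore] -/
theorem mono_cut_transfer (N n len kpos : ℕ) (φ : ℕ → ℕ) (P : ℕ → ℕ → Prop) (rel : ℕ → ℕ → Prop)
    (hφ : Monotone φ) (hφn : ∀ k, k ≤ len → φ k ≤ n) (hnN : n ≤ N) (hrefl : ∀ a, rel a a)
    (hPfun : ∀ q a b, P q a → P q b → a = b) (hPN : ∀ a, ¬ P N a)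
    (hk : ∀ q q' a b, q < q' → q' < N → (q' < kpos ∨ kpos ≤ q) → P q a → P q' b → rel a b) :
    ∃ kcut : ℕ, ∀ k k' a b, k < k' → k' ≤ len → (k' < kcut ∨ kcut ≤ k) → P (φ k) a → P (φ k') b → rel a b := by
  classical
  -- the positions are `< N` where `P` holds, and comparable
  have main : ∀ k k' a b, k < k' → k' ≤ len → (φ k' < kpos ∨ kpos ≤ φ k) → P (φ k) a → P (φ k') b →
      rel a b := by
    intro k k' a b hkk' hk' hs ha hb
    rcases (hφ hkk'.le).eq_or_lt with heq | hlt
    · rw [heq] at ha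
      rw [hPfun _ _ _ ha hb]
      exact hrefl b
    · have hN' : φ k' < N := by
        rcases (le_trans (hφn k' hk') hnN).eq_or_lt with h | h
        · exact absurd (h ▸ hb) (hPN b)
        · exact h
      exact hk _ _ a b hlt hN' hs ha hb
  by_cases hex : ∃ k, k ≤ len ∧ kpos ≤ φ k
  · refine ⟨Nat.find hex, fun k k' a b hkk' hk' hs ha hb => main k k' a b hkk' hk' ?_ ha hb⟩
    rcases hs with hs | hs
    · exact Or.inl (lt_of_not_ge fun hge => Nat.find_min hex hs ⟨hk', hge⟩)
    · exact Or.inr ((Nat.find_spec hex).2.trans (hφ hs))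
  · refine ⟨len + 1, fun k k' a b hkk' hk' _ ha hb => main k k' a b hkk' hk' ?_ ha hb⟩
    exact Or.inl (lt_of_not_ge fun hge => hex ⟨k', hk', hge⟩)

/-! ### The registered stub -/

/-- **Witness glue T5 (registered): block-monotone contact index on a far piece along the outline arc.**
See the file header for the statement and the proof. [folklore] -/
theorem witness_blockMonotone : ∀ {D : DobrushinDomain} (cfg : FarTipCfg D) (F B : Finset (Site 2)) (e₀ : Site 2 × ODir) (n₁ N m n : ℕ) (p : (zdGraph 2).Walk (bsite (btour (↑F : Set (Site 2)) e₀ m)) (bsite (btour (↑F : Set (Site 2)) e₀ n))) (φ : ℕ → ℕ) (i'' : ℕ), (∀ x, x ∈ F ↔ x ∈ cfg.Fset) → (∀ x, x ∈ B ↔ x ∈ cfg.Bset) → (∀ x ∈ B, x ∈ cfg.Λ) → 2 ≤ F.card → (∀ x ∈ F, x ∉ cfg.K) → (∀ x ∈ F, ∀ y ∈ F, ∃ w : (zdGraph 2).Walk x y, ∀ z ∈ w.support, z ∈ F) → (∀ x ∈ F, ∀ y : Site 2, y ∉ F → (zdGraph 2).Adj x y → y ∈ cfg.K ∨ y ∈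 cfg.C.support) → (∀ x ∈ F, ∀ y ∈ F, (zdGraph 2).Adj x y → cfg.G.Adj x y) → (∀ x ∈ B, ∀ y ∈ B, (zdGraph 2).Adj x y → cfg.G.Adj x y) → (∀ k ∈ cfg.K, ∃ (q : Site 2) (w : (zdGraph 2).Walk k q), q ∈ cfg.C.support ∧ ∀ z ∈ w.support, z ∈ cfg.K ∨ z ∈ cfg.C.support) → IsBEdge (↑F : Set (Site 2)) e₀ → bsite e₀ = cfg.t₀ → bcontact e₀ = cfg.γ.getVert (cfg.τ - 1) → 0 < n₁ → n₁ < N → btour (↑F : Set (Site 2)) e₀ N = e₀ → (∀ j j', j < N → j' < N → btour (↑F : Set (Site 2)) e₀ j = btour (↑F : Set (Site 2)) e₀ j' → j = j') → ((m = 0 ∧ n = n₁) ∨ (m = n₁ ∧ n = N)) → (∀ z ∈ p.support, z ∈ F) → Monotone φ → (∀ k, k ≤ p.length → m ≤ φ k ∧ φ k ≤ n) → i'' ∈ cfg.farStarts → cfg.NonDeg i'' → i'' ≠ cfg.i → ∃ kcut : ℕ, (∀ (k k' m₁ m₂ : ℕ), k < k' → k' ≤ p.length → (k' < kcut ∨ kcut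 ≤ k) → i'' < m₁ → m₁ < cfg.pend i'' → i'' < m₂ → m₂ < cfg.pend i'' → bcontact (btour (↑F : Set (Site 2)) e₀ (φ k)) = cfg.γ.getVert m₁ → bcontact (btour (↑F : Set (Site 2)) e₀ (φ k')) = cfg.γ.getVert m₂ → m₁ ≤ m₂) ∨ (∀ (k k' m₁ m₂ : ℕ), k < k' → k' ≤ p.length → (k' < kcut ∨ kcut ≤ k) → i'' < m₁ → m₁ < cfg.pend i'' → i'' < m₂ → m₂ < cfg.pend i'' → bcontact (btour (↑F : Set (Site 2)) e₀ (φ k)) = cfg.γ.getVert m₁ → bcontact (btour (↑F : Set (Site 2)) e₀ (φ k')) = cfg.γ.getVert m₂ → m₂ ≤ m₁) := by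
  intro D cfg F B e₀ n₁ N m n p φ i'' hF hB hBΛ hF2 hFK hFconn hFbdry _ _ _ he₀ _ he₀c hn₁ hn₁N hN hinj hmn _ hφ
    hφmn hi hnd hne
  -- `F ⊆ Λ`
  have hFΛ : ∀ x ∈ F, x ∈ cfg.Λ := fun x hx => hBΛ x ((hB x).2 (cfg.Fset_subset_Bset ((hF x).1 hx)))
  -- the piece and the obstacle path
  have hRp := rest_isPiece_pend cfg hi
  have hnd' : i'' + 3 ≤ cfg.pend i'' := hnd
  have hL : cfg.pend i'' ≤ cfg.γ.length := hRp.2.1.1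
  have hf := cfg.idx_facts
  obtain ⟨r, hr, hrlen, hrv⟩ := mono_chordSlice cfg (i := i'') (j := cfg.pend i'') (by omega) hL
  have hL2 : 2 ≤ r.length := by omega
  have hrv' : ∀ k, k ≤ r.length → r.getVert k = cfg.γ.getVert (i'' + k) := fun k hk => hrv k (by omega)
  have hrsupp : ∀ z ∈ r.support, ∃ k, k ≤ r.length ∧ z = cfg.γ.getVert (i'' + k) := by
    intro z hz
    rw [SimpleGraph.Walk.mem_support_iff_exists_getVert] at hz
    obtain ⟨k, rfl, hk⟩ := hz
    exact ⟨k, hk, hrv' k hk⟩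
  have hrF : ∀ z ∈ r.support, z ∉ F := by
    intro z hz hzF
    obtain ⟨k, hk, rfl⟩ := hrsupp z hz
    exact hFK _ hzF (mono_mem_K cfg hi hne (by omega) (by omega))
  -- interior vertices of `r` versus interior indices of the piece
  have hint : ∀ z, (∀ m', i'' < m' → m' < cfg.pend i'' → z ≠ cfg.γ.getVert m') →
      ∀ n', 0 < n' → n' < r.length → z ≠ r.getVert n' := by
    intro z hz n' h0 hL'
    rw [hrv' n' hL'.le]
    exact hz _ (by omega) (by omega)
  have hint' : ∀ z, (∀ n', 0 < n' → n' < r.length → z ≠ r.getVert n') →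
      ∀ m', i'' < m' → m' < cfg.pend i'' → z ≠ cfg.γ.getVert m' := by
    intro z hz m' h1 h2
    have := hz (m' - i'') (by omega) (by omega)
    rwa [hrv' _ (by omega), show i'' + (m' - i'') = m' by omega] at this
  -- escapes
  obtain ⟨Rbig, hRF, hRγ, hesc⟩ := mono_escapes cfg F i'' hFΛ hFK hi hnd
  have hR : ∀ z : Site 2, (z ∈ F ∨ z ∈ r.support) → z 0 + 2 ≤ Rbig := by
    rintro z (hz | hz)
    · exact hRF z hz
    · obtain ⟨k, hk, rfl⟩ := hrsupp z hz
      exact hRγ _ (by omega) (by omega)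
  have hescR : ∀ c, (c ∈ cfg.K ∨ c ∈ cfg.C.support) → (∀ n', 0 < n' → n' < r.length → c ≠ r.getVert n') →
      ∃ (c' : Site 2) (ε : (zdGraph 2).Walk c c'), Rbig ≤ c' 0 ∧
        ∀ z ∈ ε.support, z ∉ F ∧ ∀ n', 0 < n' → n' < r.length → z ≠ r.getVert n' := by
    intro c hcK hc
    obtain ⟨c', ε, hc', hε⟩ := hesc c hcK (hint' c hc)
    exact ⟨c', ε, hc', fun z hz => ⟨(hε z hz).1, hint z (hε z hz).2⟩⟩
  -- escapes from the two spine endpoints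
  obtain ⟨u₁, εu, hu₁, hεu⟩ := hescR _ (Or.inl (mono_mem_K cfg hi hne le_rfl (by omega)))
    (hint _ fun m' h1 h2 heq => by have := mono_γ_inj cfg (by omega) (by omega) heq; omega)
  obtain ⟨v₁, εv, hv₁, hεv⟩ := hescR _ (Or.inl (mono_mem_K cfg hi hne (by omega) le_rfl))
    (hint _ fun m' h1 h2 heq => by have := mono_γ_inj cfg (by omega) (by omega) heq; omega)
  -- the `F`-edge `(bsite e₀, bcontact e₀)` and the escape from its contact `γ(τ-1)`
  obtain ⟨ha₀, hc₀, hac⟩ := bcontact_spec (↑F : Set (Site 2)) he₀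
  have hc₀K : bcontact e₀ ∈ cfg.K := by
    rw [he₀c, FarTipCfg.K_def, Finset.mem_union]
    exact Or.inr (cfg.mem_Ext_iff.2 ⟨cfg.τ - 1, by omega, Or.inl (by omega), rfl⟩)
  have hc₀int : ∀ n', 0 < n' → n' < r.length → bcontact e₀ ≠ r.getVert n' :=
    hint _ fun m' h1 h2 => by rw [he₀c]; exact mono_pred_tip_ne cfg hi hne h1 h2
  obtain ⟨c₁, εc, hc₁, hεc⟩ := hescR _ (Or.inl hc₀K) hc₀int
  have ha₀' : bsite e₀ ∈ F := Finset.mem_coe.1 ha₀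
  have hc₀' : bcontact e₀ ∉ F := fun h => hc₀ (Finset.mem_coe.2 h)
  -- contact escapes
  have hescC : ∀ c : Site 2, c ∉ F → (∀ n', 0 < n' → n' < r.length → c ≠ r.getVert n') →
      (∃ a ∈ F, (zdGraph 2).Adj a c) → ∃ (c' : Site 2) (ε : (zdGraph 2).Walk c c'), Rbig ≤ c' 0 ∧
        ∀ z ∈ ε.support, z ∉ F ∧ ∀ n', 0 < n' → n' < r.length → z ≠ r.getVert n' := by
    rintro c hcF hc ⟨a, ha, hadj⟩
    exact hescR c (hFbdry a ha c hcF hadj) hc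
  -- positions carrying interior contacts
  have hNpos : 0 < N := by omega
  set P : ℕ → ℕ → Prop := fun q a => i'' < a ∧ a < cfg.pend i'' ∧
    bcontact (btour (↑F : Set (Site 2)) e₀ q) = cfg.γ.getVert a with hP
  have hPfun : ∀ q a b, P q a → P q b → a = b := fun q a b ⟨_, ha2, ha⟩ ⟨_, hb2, hb⟩ =>
    mono_γ_inj cfg (by omega) (by omega) (ha.symm.trans hb)
  have hPN : ∀ a, ¬ P N a := fun a ⟨ha1, ha2, ha⟩ => by
    rw [hN, he₀c] at ha
    exact mono_pred_tip_ne cfg hi hne ha1 ha2 ha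
  have hφn : ∀ k, k ≤ p.length → φ k ≤ n := fun k hk => (hφmn k hk).2
  have hnN : n ≤ N := by rcases hmn with ⟨-, rfl⟩ | ⟨-, rfl⟩ <;> omega
  have hPr : ∀ q a, P q a → 0 < a - i'' ∧ a - i'' < r.length ∧
      bcontact (btour (↑F : Set (Site 2)) e₀ q) = r.getVert (a - i'') := by
    rintro q a ⟨ha1, ha2, ha⟩
    refine ⟨by omega, by omega, ?_⟩
    rw [hrv' _ (by omega), show i'' + (a - i'') = a by omega]
    exact ha
  -- one-sidedness, then block monotonicity along positions, then along vertex indices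
  rcases mono_oneSided F r Rbig u₁ v₁ εu εv hr hL2 hFconn hrF hR hu₁ hv₁ hεu hεv with hleft | hright
  · obtain ⟨kpos, hk⟩ := mono_posMonotone_left F e₀ N r Rbig u₁ v₁ (bsite e₀) (bcontact e₀) c₁ εu εv εc he₀ hNpos
      hN hinj hr hL2 hF2 hFconn hrF hleft hR hu₁ hv₁ hc₁ hεu hεv ha₀' hc₀' hac hc₀int hεc hescC
    obtain ⟨kcut, hcut⟩ := mono_cut_transfer N n p.length kpos φ P (· ≤ ·) hφ hφn hnN le_refl hPfun hPN
      (fun q q' a b hqq' hq'N hs ha hb => by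
        obtain ⟨h0, hL', hq⟩ := hPr q a ha
        obtain ⟨h0', hL'', hq'⟩ := hPr q' b hb
        have := hk q q' _ _ hqq' hq'N hs h0 hL' h0' hL'' hq hq'
        change a ≤ b
        omega)
    exact ⟨kcut, Or.inl fun k k' m₁ m₂ hkk' hk' hs h1 h2 h3 h4 h5 h6 =>
      hcut k k' m₁ m₂ hkk' hk' hs ⟨h1, h2, h5⟩ ⟨h3, h4, h6⟩⟩
  · obtain ⟨kpos, hk⟩ := mono_posMonotone_right F e₀ N r Rbig u₁ v₁ (bsite e₀) (bcontact e₀) c₁ εu εv εc he₀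
      hNpos hN hinj hr hL2 hF2 hFconn hrF hright hR hu₁ hv₁ hc₁ hεu hεv ha₀' hc₀' hac hc₀int hεc hescC
    obtain ⟨kcut, hcut⟩ := mono_cut_transfer N n p.length kpos φ P (fun a b => b ≤ a) hφ hφn hnN (fun a => le_refl a)
      hPfun hPN (fun q q' a b hqq' hq'N hs ha hb => by
        obtain ⟨h0, hL', hq⟩ := hPr q a ha
        obtain ⟨h0', hL'', hq'⟩ := hPr q' b hb
        have := hk q q' _ _ hqq' hq'N hs h0 hL' h0' hL'' hq hq'
        change b ≤ a
        omega)
    exact ⟨kcut, Or.inr fun k k' m₁ m₂ hkk' hk' hs h1 h2 h3 h4 h5 h6 =>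
      hcut k k' m₁ m₂ hkk' hk' hs ⟨h1, h2, h5⟩ ⟨h3, h4, h6⟩⟩

end Summit.CriticalPhenomena.SAWScalingLimit.Theorems.FKGToTraversalBound.SlitNecklace

end
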